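import Summits.ValiantsHypothesis.ValiantsHypothesis.Theorems.KPlusLogSqLawTropicalBSymmetricOrbits
import Summits.ValiantsHypothesis.ValiantsHypothesis.Theorems.KPlusLogSqLawTropicalBRelabel

/-!
# Route `KPlusLogSqLaw`, crux `TropicalB` — GAUGE symmetries (symmetry up to row/column potentials)

HONEST FRAMING.  Helper toward the registered stubs `stub_tropThin` / `stub_tropFat` of
`Cruxes/TropicalB/Lines/birth.lean` (crux `Summit.ValiantsHypothesis.ValiantsHypothesis.Theses.KPlusLogSqLaw.TropicalB`,
ledger item `stmt-ValiantsHypothesis-19771`, route `KPlusLogSqLaw`; cell `pub-symmetroid`, seat `val-sym-trop-p3`,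
2026-08-26).  Extends this seat's `…TropicalBSymmetricOrbits` (p426340).  OBJECT-SYMMETRY sector of an OPEN conjecture;
nothing here bounds `TropicalB` for general designs, and nothing bears on `KPlusLogSqLaw`, `MatrixDescartes`, `VP ≠ VNP`.

THE POINT.  Dominance is invariant under adding class-independent ROW and COLUMN POTENTIALS to the valuations
(`isDominant_addPotential_iff`: every Leibniz term meets every row and every column once, so all weights shift by the
same constant — the standard gauge of the assignment problem).  Hence the symmetry principle (val-sym-trop-p2) and the
orbit count (this seat) only need a GAUGE symmetry: a relabelling pair `(α, β)` with
`v (α a) (β b) l = v a b l + F a + G b` (potentials `F, G` independent of the class) and `ε (α a) (β b) l = ε a b l`.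
This is strictly weaker than exact symmetry (on `Fin 2` with the swap, `F = (1,1)`, `G = (0,−2)` is a gauge symmetry of a
non-symmetric design that no potential renormalisation makes symmetric).

* `isDominant_fixed_of_gaugeSymmetry'` : dominant terms are fixed by every gauge symmetry;
* `card_le_pow_of_gaugeSymmetry` / `chain_succ_le_pow_of_gaugeSymmetry` : `n + 1 ≤ m^|T| · K^|T|` for `T` meeting every
  forward `β`-orbit; `gaugeSymmetry_kPlusLogSq_adaptive` : `C = 2` when `|T|·(log₂ m + 1) ≤ K + log₂² m`;
* GAUGE-CIRCULANT designs (`v (a+1) (b+1) l = v a b l + F a + G b`, e.g. a cyclic-difference core plus ARBITRARY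
  class-independent row and column potentials `v a b l = w (a − b) l + f a + g b`; `ε` circulant):
  `gaugeCirculant_chain_succ_le : n + 1 ≤ m·K` and `gaugeCirculant_kPlusLogSq` (`C = 2`).  Located boundary: the column
  price `2(b+1)` of SHIFT-THREE (`…TropicalShiftThree`) is a CLASS-DEPENDENT potential (class `1` only) — exactly what
  escapes this sector (SHIFT-THREE has `≈ m²/2` dominant terms).  (val-sym-trop-p2's TOEPLITZ lane concerns the integer
  difference `a − b`, not the cyclic one; no overlap is claimed.)
[folklore: LP gauge of the assignment problem; uniqueness of an optimum ⇒ invariance]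
-/

set_option linter.dupNamespace false
set_option autoImplicit false

namespace Summit.ValiantsHypothesis.ValiantsHypothesis.Theorems.KPlusLogSqLaw

open Summit.ValiantsHypothesis.ValiantsHypothesis.Theorems.MatrixDescartes.Negative
open Summit.ValiantsHypothesis.ValiantsHypothesis.Theorems.LacunarySymmetroidMatrixDescartes
open Summit.ValiantsHypothesis.ValiantsHypothesis.Theorems.LacunarySymmetroidMatrixDescartes.TropicalCensus
open scoped BigOperators
open Finset

section Gauge

variable {m K : ℕ}

/-- **Potential shift of the weight**: adding row and column potentials `F a + G b` to every valuation lowers the weight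
of EVERY term by the same constant `Σ_a F a + Σ_b G b`. [folklore] -/
theorem tropWeight_addPotential (d : Fin K → ℕ) (v : Fin m → Fin m → Fin K → ℤ) (F G : Fin m → ℤ) (θ : ℤ)
    (q : Equiv.Perm (Fin m) × (Fin m → Fin K)) :
    tropWeight d (fun a b l => v a b l + F a + G b) θ q = tropWeight d v θ q - (∑ a, F a + ∑ b, G b) := by
  unfold tropWeight
  simp only [sum_add_distrib]
  have e : ∑ i, F (q.1 i) = ∑ a, F a := Equiv.sum_comp q.1 F
  rw [e]
  ring

/-- **Dominance is gauge invariant**: adding class-independent row/column potentials does not change which terms are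
dominant. [folklore] -/
theorem isDominant_addPotential_iff (d : Fin K → ℕ) (v ε : Fin m → Fin m → Fin K → ℤ) (F G : Fin m → ℤ) (θ : ℤ)
    (q : Equiv.Perm (Fin m) × (Fin m → Fin K)) :
    IsDominant d (fun a b l => v a b l + F a + G b) ε θ q ↔ IsDominant d v ε θ q := by
  unfold IsDominant
  simp only [tropWeight_addPotential, sub_lt_sub_iff_right]

/-- **Dominant terms are fixed by gauge symmetries**: if `v (α a) (β b) l = v a b l + F a + G b` and
`ε (α a) (β b) l = ε a b l`, every dominant term `(σ, λ)` satisfies `α σ β⁻¹ = σ` and `λ ∘ β⁻¹ = λ`. [folklore] -/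
theorem isDominant_fixed_of_gaugeSymmetry' (d : Fin K → ℕ) (v ε : Fin m → Fin m → Fin K → ℤ)
    (α β : Equiv.Perm (Fin m)) (F G : Fin m → ℤ)
    (hv : ∀ a b l, v (α a) (β b) l = v a b l + F a + G b) (hε : ∀ a b l, ε (α a) (β b) l = ε a b l) (θ : ℤ)
    (σ : Equiv.Perm (Fin m)) (μ : Fin m → Fin K) (hp : IsDominant d v ε θ (σ, μ)) :
    α * σ * β⁻¹ = σ ∧ (fun j => μ (β.symm j)) = μ := by
  -- the relabelled term is dominant for the relabelled design, which is the gauged design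
  have hv' : (fun a b l => v (α a) (β b) l) = fun a b l => v a b l + F a + G b := by
    funext a b l; exact hv a b l
  have hε' : (fun a b l => ε (α a) (β b) l) = ε := by
    funext a b l; exact hε a b l
  have hrel : IsDominant d v ε θ (α * σ * β⁻¹, fun j => μ (β⁻¹ j)) := by
    rw [isDominant_relabel_iff d v ε α β (σ, μ) θ, hv', hε', isDominant_addPotential_iff]
    exact hp
  -- two dominant terms at the same slope coincide
  have heq : ((α * σ * β⁻¹ : Equiv.Perm (Fin m)), fun j => μ (β⁻¹ j)) = (σ, μ) := by
    by_contra hne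
    have h1 := hp.2 _ hne hrel.1
    have h2 := hrel.2 _ (Ne.symm hne) hp.1
    exact lt_asymm h1 h2
  exact Prod.mk.inj heq

/-- **Few dominant terms under a gauge symmetry (core).**  `n + 1 ≤ m^|T| · K^|T|` for every injective family of
dominant terms, `T` meeting every forward `β`-orbit. [folklore] -/
theorem card_le_pow_of_gaugeSymmetry (d : Fin K → ℕ) (v ε : Fin m → Fin m → Fin K → ℤ)
    (α β : Equiv.Perm (Fin m)) (F G : Fin m → ℤ)
    (hv : ∀ a b l, v (α a) (β b) l = v a b l + F a + G b) (hε : ∀ a b l, ε (α a) (β b) l = ε a b l)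
    (T : Finset (Fin m)) (hT : ∀ b : Fin m, ∃ t ∈ T, ∃ j : ℕ, (β ^ j) t = b)
    {n : ℕ} (θ : Fin (n + 1) → ℤ) (p : Fin (n + 1) → Equiv.Perm (Fin m) × (Fin m → Fin K))
    (hdom : ∀ k, IsDominant d v ε (θ k) (p k)) (hinj : Function.Injective p) :
    n + 1 ≤ m ^ T.card * K ^ T.card := by
  classical
  have hfix : ∀ k, α * (p k).1 * β⁻¹ = (p k).1 ∧ (fun j => (p k).2 (β.symm j)) = (p k).2 := fun k =>
    isDominant_fixed_of_gaugeSymmetry' d v ε α β F G hv hε (θ k) (p k).1 (p k).2 (hdom k)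
  let Φ : Fin (n + 1) → (T → Fin m) × (T → Fin K) := fun k => (fun t => (p k).1 t, fun t => (p k).2 t)
  have hΦ : Function.Injective Φ := by
    intro k k' hkk
    have h1 : ∀ t ∈ T, (p k).1 t = (p k').1 t := fun t ht => by
      have := congrArg (fun G : (T → Fin m) × (T → Fin K) => G.1 ⟨t, ht⟩) hkk
      simpa [Φ] using this
    have h2 : ∀ t ∈ T, (p k).2 t = (p k').2 t := fun t ht => by
      have := congrArg (fun G : (T → Fin m) × (T → Fin K) => G.2 ⟨t, ht⟩) hkk
      simpa [Φ] using this
    apply hinj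
    refine Prod.ext (Equiv.ext fun b => ?_) (funext fun b => ?_)
    · obtain ⟨t, ht, j, rfl⟩ := hT b
      rw [apply_pow_of_fixed α β _ (hfix k).1, apply_pow_of_fixed α β _ (hfix k').1, h1 t ht]
    · obtain ⟨t, ht, j, rfl⟩ := hT b
      rw [class_pow_of_fixed β _ (hfix k).2, class_pow_of_fixed β _ (hfix k').2, h2 t ht]
  have hcard := Fintype.card_le_of_injective Φ hΦ
  simpa [Fintype.card_fin, Fintype.card_prod, Fintype.card_fun, Fintype.card_coe] using hcard

/-- **Signed chains under a gauge symmetry**: `n + 1 ≤ m^|T| · K^|T|`. [folklore] -/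
theorem chain_succ_le_pow_of_gaugeSymmetry (d : Fin K → ℕ) (v ε : Fin m → Fin m → Fin K → ℤ)
    (α β : Equiv.Perm (Fin m)) (F G : Fin m → ℤ)
    (hv : ∀ a b l, v (α a) (β b) l = v a b l + F a + G b) (hε : ∀ a b l, ε (α a) (β b) l = ε a b l)
    (T : Finset (Fin m)) (hT : ∀ b : Fin m, ∃ t ∈ T, ∃ j : ℕ, (β ^ j) t = b)
    {n : ℕ} (θ : Fin (n + 1) → ℤ) (p : Fin (n + 1) → Equiv.Perm (Fin m) × (Fin m → Fin K))
    (hθ : StrictMono θ) (hdom : ∀ k, IsDominant d v ε (θ k) (p k))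
    (halt : ∀ k : Fin n, termSign ε (p k.castSucc) * termSign ε (p k.succ) < 0) :
    n + 1 ≤ m ^ T.card * K ^ T.card :=
  card_le_pow_of_gaugeSymmetry d v ε α β F G hv hε T hT θ p hdom
    (stub_dominantInjective m K d v ε n θ p hθ hdom halt)

/-- **K-adaptive `K + log² m` law under a gauge symmetry** (`C = 2` when `|T|·(log₂ m + 1) ≤ K + log₂² m`). [folklore] -/
theorem gaugeSymmetry_kPlusLogSq_adaptive (d : Fin K → ℕ) (v ε : Fin m → Fin m → Fin K → ℤ)
    (α β : Equiv.Perm (Fin m)) (F G : Fin m → ℤ)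
    (hv : ∀ a b l, v (α a) (β b) l = v a b l + F a + G b) (hε : ∀ a b l, ε (α a) (β b) l = ε a b l)
    (T : Finset (Fin m)) (hT : ∀ b : Fin m, ∃ t ∈ T, ∃ j : ℕ, (β ^ j) t = b)
    (hTcard : T.card * (Nat.log 2 m + 1) ≤ K + Nat.log 2 m ^ 2) (hε1 : ∀ i j l, (ε i j l).natAbs ≤ 1)
    {n : ℕ} (θ : Fin (n + 1) → ℤ) (p : Fin (n + 1) → Equiv.Perm (Fin m) × (Fin m → Fin K))
    (hθ : StrictMono θ) (hdom : ∀ k, IsDominant d v ε (θ k) (p k))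
    (halt : ∀ k : Fin n, termSign ε (p k.castSucc) * termSign ε (p k.succ) < 0) :
    n ≤ 2 ^ (2 * (K + Nat.log 2 m ^ 2)) := by
  rcases le_or_gt K m with hK | hK
  · have h1 := chain_succ_le_pow_of_gaugeSymmetry d v ε α β F G hv hε T hT θ p hθ hdom halt
    have h2 := pow_mul_pow_le_two_pow_adaptive m K T.card hTcard hK
    omega
  · have h := tropRootLawAt_fatEnd (m := m) (K := K) hK.le d v ε n θ p hε1 hθ hdom halt
    exact h.trans (Nat.pow_le_pow_right (by norm_num) (by nlinarith))

/-! ### Gauge-circulant designs -/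

/-- **Gauge-circulant designs have at most `m·K` dominant terms**: if translating rows and columns by one step changes
the valuations only by class-independent row/column potentials (`v (ρ a) (ρ b) l = v a b l + F a + G b`,
`ρ = finRotate m`) and preserves `ε`, every sign-alternating dominant chain has `n + 1 ≤ m·K`. [folklore] -/
theorem gaugeCirculant_chain_succ_le (hm : 0 < m) (d : Fin K → ℕ) (v ε : Fin m → Fin m → Fin K → ℤ)
    (F G : Fin m → ℤ) (hv : ∀ a b l, v ((finRotate m) a) ((finRotate m) b) l = v a b l + F a + G b)
    (hε : ∀ a b l, ε ((finRotate m) a) ((finRotate m) b) l = ε a b l)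
    {n : ℕ} (θ : Fin (n + 1) → ℤ) (p : Fin (n + 1) → Equiv.Perm (Fin m) × (Fin m → Fin K))
    (hθ : StrictMono θ) (hdom : ∀ k, IsDominant d v ε (θ k) (p k))
    (halt : ∀ k : Fin n, termSign ε (p k.castSucc) * termSign ε (p k.succ) < 0) :
    n + 1 ≤ m * K := by
  classical
  have hT : ∀ b : Fin m, ∃ t ∈ ({⟨0, hm⟩} : Finset (Fin m)), ∃ j : ℕ, ((finRotate m) ^ j) t = b := by
    intro b
    refine ⟨⟨0, hm⟩, mem_singleton_self _, (b : ℕ), ?_⟩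
    have h := finRotate_pow_apply_of_lt (m := m) (b : ℕ) ⟨0, hm⟩ (by simp only; omega)
    rw [h]; apply Fin.ext; simp
  have h := chain_succ_le_pow_of_gaugeSymmetry d v ε (finRotate m) (finRotate m) F G hv hε {⟨0, hm⟩} hT
    θ p hθ hdom halt
  simpa using h

/-- **Gauge-circulant designs satisfy the `K + log² m` law with `C = 2`.** [folklore] -/
theorem gaugeCirculant_kPlusLogSq (d : Fin K → ℕ) (v ε : Fin m → Fin m → Fin K → ℤ)
    (F G : Fin m → ℤ) (hv : ∀ a b l, v ((finRotate m) a) ((finRotate m) b) l = v a b l + F a + G b)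
    (hε : ∀ a b l, ε ((finRotate m) a) ((finRotate m) b) l = ε a b l) (hε1 : ∀ i j l, (ε i j l).natAbs ≤ 1)
    {n : ℕ} (θ : Fin (n + 1) → ℤ) (p : Fin (n + 1) → Equiv.Perm (Fin m) × (Fin m → Fin K))
    (hθ : StrictMono θ) (hdom : ∀ k, IsDominant d v ε (θ k) (p k))
    (halt : ∀ k : Fin n, termSign ε (p k.castSucc) * termSign ε (p k.succ) < 0) :
    n ≤ 2 ^ (2 * (K + Nat.log 2 m ^ 2)) := by
  classical
  rcases Nat.eq_zero_or_pos K with hK0 | hK0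
  · subst hK0
    have hn : n ≤ 0 := tropRootLawAt_zero m 0 d v ε n θ p hε1 hθ hdom halt
    exact hn.trans (Nat.zero_le _)
  rcases Nat.eq_zero_or_pos m with hm0 | hm0
  · subst hm0
    have h := chain_succ_le_pow_of_gaugeSymmetry d v ε (finRotate 0) (finRotate 0) F G hv hε ∅
      (fun b => b.elim0) θ p hθ hdom halt
    simp only [card_empty, pow_zero, mul_one] at h
    exact (show n ≤ 0 by omega).trans (Nat.zero_le _)
  have hT : ∀ b : Fin m, ∃ t ∈ ({⟨0, hm0⟩} : Finset (Fin m)), ∃ j : ℕ, ((finRotate m) ^ j) t = b := by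
    intro b
    refine ⟨⟨0, hm0⟩, mem_singleton_self _, (b : ℕ), ?_⟩
    have h := finRotate_pow_apply_of_lt (m := m) (b : ℕ) ⟨0, hm0⟩ (by simp only; omega)
    rw [h]; apply Fin.ext; simp
  refine gaugeSymmetry_kPlusLogSq_adaptive d v ε (finRotate m) (finRotate m) F G hv hε {⟨0, hm0⟩} hT ?_ hε1
    θ p hθ hdom halt
  rw [card_singleton, one_mul]
  have : Nat.log 2 m ≤ Nat.log 2 m ^ 2 := by nlinarith
  omega

end Gauge

end Summit.ValiantsHypothesis.ValiantsHypothesis.Theorems.KPlusLogSqLaw
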